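import Summits.CriticalPhenomena.Ising3DConformalLimit.Theorems.MoebiusLimitOfTwoPointLaw.Negative.CanonicalForm
import Literature.Probability.LatticeModels.CriticalUrsellFourSign
import Literature.Probability.LatticeModels.PlusFreeComparison

/-!
# `MoebiusLimitOfTwoPointLaw` (crux `stmt-CriticalPhenomena-4801`): the arities `n ≤ 3` of the canonical
# limit are SETTLED by the two-point law (negative-side support)

Support file of the crux disprover (cdisprove seat, cycle 2); companion of `CanonicalForm.lean` and
`EvenReduction.lean`. With the canonical renormalisation `ρ(δ) = δ^{-Δ}` read from a witness `(Δ, c)` of item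
0634, the rescaled critical correlators of `ℤ³` converge locally uniformly off the diagonals

* in arity `0` to `1` (`tendstoLocallyUniformlyOn_arity_zero`; `⟨1⟩ = 1`, `plusCorr_empty`),
* in every odd arity to `0` (`tendstoLocallyUniformlyOn_arity_odd`; odd critical correlators vanish on `ℤ³`,
  `criticalCorr_eq_zero_of_odd`, i.e. `m*(β_c(3)) = 0`, Aizenman–Duminil-Copin–Sidoravicius 2015),
* in arity `2` to `c‖x₀ − x₁‖^{-2Δ}` (`tendstoLocallyUniformlyOn_arity_two_of_twoPointLaw`): translation
  invariance `criticalCorr_two_pair` + the two-point law along `[x₁/δ] − [x₀/δ] → ∞` + rounding moves points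
  by `≤ 3δ`.

So under item 0634 the content of item 1344 sits entirely in the EVEN arities `n ≥ 4` (`EvenReduction.lean`).
All statements are `sorry`-free; the model-specific inputs are exactly the three tree theorems just named.
-/

noncomputable section

namespace Summit.CriticalPhenomena.Ising3DConformalLimit.Theorems.MoebiusLimitOfTwoPointLaw.Negative

open Literature.Probability.LatticeModels Filter Topology
open Literature.Barriers.CriticalPhenomena.ScaleNotMoebius (twoPt twoPt_pos norm_toLp_intCast dist_round_le
  tendstoLocallyUniformlyOn_comp_approx continuousOn_twoPt injective_fin_two_iff sqrt_sum_sq_pos)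

/-! ## §1 Arity `0` and odd arities -/

/-- `⟨1⟩⁺_{β_c} = 1` on `ℤ³` (empty spin monomial; `plusCorr_empty`). -/
theorem criticalCorr_arity_zero (x : Fin 0 → Site 3) : criticalCorr 3 0 x = 1 := by
  have h : criticalCorr 3 0 x = plusCorr 3 (criticalBeta 3) 0 ∅ := by
    change plusExpect 3 (criticalBeta 3) 0 (spinMonomial x) = plusExpect 3 (criticalBeta 3) 0 (spinProduct ∅)
    congr 1
  rw [h, plusCorr_empty (criticalBeta_nonneg 3) le_rfl]

/-- In arity `0` every rescaled critical correlator is `1`. -/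
theorem rescaledCorrelator_arity_zero (ρ : ℝ → ℝ) (δ : ℝ) (x : Fin 0 → EuclideanSpace ℝ (Fin 3)) :
    rescaledCorrelator (criticalCorr 3) ρ 0 δ x = 1 := by
  rw [rescaledCorrelator_apply, pow_zero, one_mul, criticalCorr_arity_zero]

/-- In odd arity every rescaled critical correlator of `ℤ³` is `0`. -/
theorem rescaledCorrelator_arity_odd (ρ : ℝ → ℝ) {n : ℕ} (hn : Odd n) (δ : ℝ)
    (x : Fin n → EuclideanSpace ℝ (Fin 3)) : rescaledCorrelator (criticalCorr 3) ρ n δ x = 0 := by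
  rw [rescaledCorrelator_apply, criticalCorr_eq_zero_of_odd le_rfl hn, mul_zero]

/-- Arity `0`: convergence to the constant `1` (any renormalisation). -/
theorem tendstoLocallyUniformlyOn_arity_zero (ρ : ℝ → ℝ) :
    TendstoLocallyUniformlyOn (rescaledCorrelator (criticalCorr 3) ρ 0) (fun _ => 1) (𝓝[>] (0 : ℝ))
      (NonCoincident 3 0) := by
  rw [Metric.tendstoLocallyUniformlyOn_iff]
  intro ε hε x _
  refine ⟨Set.univ, Filter.univ_mem, Filter.Eventually.of_forall fun δ y _ => ?_⟩
  simp only [rescaledCorrelator_arity_zero, dist_self]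
  exact hε

/-- Odd arity: convergence to `0` (any renormalisation). -/
theorem tendstoLocallyUniformlyOn_arity_odd (ρ : ℝ → ℝ) {n : ℕ} (hn : Odd n) :
    TendstoLocallyUniformlyOn (rescaledCorrelator (criticalCorr 3) ρ n) (fun _ => 0) (𝓝[>] (0 : ℝ))
      (NonCoincident 3 n) := by
  rw [Metric.tendstoLocallyUniformlyOn_iff]
  intro ε hε x _
  refine ⟨Set.univ, Filter.univ_mem, Filter.Eventually.of_forall fun δ y _ => ?_⟩
  simp only [rescaledCorrelator_arity_odd ρ hn, dist_self]
  exact hε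

/-! ## §2 Arity `2` under the two-point law, canonical renormalisation -/

/-- Locally uniform convergence is insensitive to a change of the approximants that holds eventually and
LOCALLY on the set. -/
theorem tendstoLocallyUniformlyOn_congr_local {ι X : Type*} [TopologicalSpace X]
    {F G : ι → X → ℝ} {f : X → ℝ} {p : Filter ι} {s : Set X}
    (hF : TendstoLocallyUniformlyOn F f p s)
    (hev : ∀ x ∈ s, ∃ t ∈ 𝓝[s] x, ∀ᶠ n in p, Set.EqOn (F n) (G n) t) :
    TendstoLocallyUniformlyOn G f p s := by
  intro u hu x hx
  obtain ⟨t, ht, hFt⟩ := hF u hu x hx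
  obtain ⟨t', ht', hG⟩ := hev x hx
  refine ⟨t ∩ t', inter_mem ht ht', ?_⟩
  filter_upwards [hFt, hG] with n hn hG' y hy
  rw [← hG' hy.2]
  exact hn y hy.1

/-- The lattice separation `k = [x₁/δ] − [x₀/δ] ∈ ℤ³` of a pair configuration at mesh `δ`. -/
def sepSite (δ : ℝ) (x : Fin 2 → EuclideanSpace ℝ (Fin 3)) : Site 3 :=
  latticeApprox δ (x 1) - latticeApprox δ (x 0)

/-- The rounded configuration `δ[x/δ]`. -/
def roundCfg {n : ℕ} (δ : ℝ) (x : Fin n → EuclideanSpace ℝ (Fin 3)) : Fin n → EuclideanSpace ℝ (Fin 3) :=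
  fun i => δ • (WithLp.toLp 2 fun j => ((latticeApprox δ (x i) j : ℤ) : ℝ) : EuclideanSpace ℝ (Fin 3))

/-- The amplitude factor `A = ⟨σ₀σ_k⟩_{β_c} ‖k‖₂^{2Δ} / c` at `k = [x₁/δ] − [x₀/δ]` (tends to `1`). -/
def ampl (Δ c : ℝ) (δ : ℝ) (x : Fin 2 → EuclideanSpace ℝ (Fin 3)) : ℝ :=
  criticalTwoPoint 3 (sepSite δ x) * Real.sqrt (∑ i, ((sepSite δ x i : ℝ)) ^ 2) ^ (2 * Δ) / c

/-- The rescaled critical pair correlator is `ρ(δ)² ⟨σ₀σ_k⟩_{β_c}`, `k = [x₁/δ] − [x₀/δ]` (translation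
invariance of the plus state, `criticalCorr_two_pair`). -/
theorem rescaledCorrelator_arity_two (ρ : ℝ → ℝ) (δ : ℝ) (x : Fin 2 → EuclideanSpace ℝ (Fin 3)) :
    rescaledCorrelator (criticalCorr 3) ρ 2 δ x = ρ δ ^ 2 * criticalTwoPoint 3 (sepSite δ x) := by
  rw [rescaledCorrelator_apply]
  congr 1
  have h : (fun i => latticeApprox δ (x i)) = ![latticeApprox δ (x 0), latticeApprox δ (x 1)] := by
    funext i; fin_cases i <;> rfl
  rw [h, criticalCorr_two_pair]
  rfl

/-- The rounded pair differs by `δ k`: `δ[x₁/δ] − δ[x₀/δ] = δ • k`. -/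
theorem roundCfg_one_sub_zero (δ : ℝ) (x : Fin 2 → EuclideanSpace ℝ (Fin 3)) :
    roundCfg δ x 1 - roundCfg δ x 0 =
      δ • (WithLp.toLp 2 fun j => ((sepSite δ x j : ℤ) : ℝ) : EuclideanSpace ℝ (Fin 3)) := by
  simp only [roundCfg, ← smul_sub]
  congr 1
  ext j
  simp [sepSite]

/-- The rounded pair is separated by `δ ‖k‖₂`. -/
theorem norm_roundCfg_sub {δ : ℝ} (hδ : 0 < δ) (x : Fin 2 → EuclideanSpace ℝ (Fin 3)) :
    ‖roundCfg δ x 0 - roundCfg δ x 1‖ = δ * Real.sqrt (∑ i, ((sepSite δ x i : ℝ)) ^ 2) := by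
  rw [norm_sub_rev, roundCfg_one_sub_zero, norm_smul, Real.norm_eq_abs, abs_of_pos hδ, norm_toLp_intCast]

/-- **The factorisation.** For `δ > 0` and `k ≠ 0`: `δ^{-2Δ}⟨σ₀σ_k⟩ = A · (c‖δ[x₀/δ] − δ[x₁/δ]‖^{-2Δ})`. -/
theorem rescaledCorrelator_arity_two_eq_mul {Δ c : ℝ} (hc : c ≠ 0) {δ : ℝ} (hδ : 0 < δ)
    (x : Fin 2 → EuclideanSpace ℝ (Fin 3)) (hk : sepSite δ x ≠ 0) :
    rescaledCorrelator (criticalCorr 3) (fun δ => δ ^ (-Δ)) 2 δ x =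
      ampl Δ c δ x * (c * twoPt Δ (roundCfg δ x 0) (roundCfg δ x 1)) := by
  have hS : 0 < Real.sqrt (∑ i, ((sepSite δ x i : ℝ)) ^ 2) := sqrt_sum_sq_pos hk
  have hS' : Real.sqrt (∑ i, ((sepSite δ x i : ℝ)) ^ 2) ^ (2 * Δ) ≠ 0 := (Real.rpow_pos_of_pos hS _).ne'
  have hδ' : δ ^ (-(2 * Δ)) ≠ 0 := (Real.rpow_pos_of_pos hδ _).ne'
  rw [rescaledCorrelator_arity_two, twoPt, norm_roundCfg_sub hδ, ampl]
  show (δ ^ (-Δ)) ^ 2 * criticalTwoPoint 3 (sepSite δ x) = _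
  rw [Real.mul_rpow hδ.le hS.le, Real.rpow_neg hS.le, ← Real.rpow_natCast (δ ^ (-Δ)) 2,
    ← Real.rpow_mul hδ.le, show -Δ * ((2 : ℕ) : ℝ) = -(2 * Δ) by push_cast; ring]
  field_simp

/-- Rounding error of the lattice separation, coordinatewise: `|δ k_j − (x₁ⱼ − x₀ⱼ)| < δ`. -/
theorem abs_mesh_mul_sepSite_sub_lt {δ : ℝ} (hδ : 0 < δ) (x : Fin 2 → EuclideanSpace ℝ (Fin 3)) (j : Fin 3) :
    |δ * (sepSite δ x j : ℝ) - ((x 1) j - (x 0) j)| < δ := by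
  have key : ∀ t : ℝ, 0 ≤ t - δ * (⌊t / δ⌋ : ℝ) ∧ t - δ * (⌊t / δ⌋ : ℝ) < δ := by
    intro t
    have h1 : (⌊t / δ⌋ : ℝ) ≤ t / δ := Int.floor_le _
    have h2 : t / δ < ⌊t / δ⌋ + 1 := Int.lt_floor_add_one _
    have h1' : δ * (⌊t / δ⌋ : ℝ) ≤ t := by
      have := mul_le_mul_of_nonneg_left h1 hδ.le
      rwa [mul_div_cancel₀ _ hδ.ne'] at this
    have h2' : t < δ * (⌊t / δ⌋ : ℝ) + δ := by
      have := mul_lt_mul_of_pos_left h2 hδ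
      rwa [mul_div_cancel₀ _ hδ.ne', mul_add, mul_one] at this
    constructor <;> linarith
  have e : δ * (sepSite δ x j : ℝ) - ((x 1) j - (x 0) j) =
      ((x 0) j - δ * (⌊(x 0) j / δ⌋ : ℝ)) - ((x 1) j - δ * (⌊(x 1) j / δ⌋ : ℝ)) := by
    simp only [sepSite, Pi.sub_apply, latticeApprox_apply, Int.cast_sub]
    ring
  rw [e, abs_lt]
  obtain ⟨a1, a2⟩ := key ((x 0) j)
  obtain ⟨b1, b2⟩ := key ((x 1) j)
  constructor <;> linarith

/-- Near a non-coincident pair, the lattice separation escapes every finite set, uniformly: if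
`x*₀ⱼ ≠ x*₁ⱼ` then for `y` within `η/4` of `x*` (`η = |x*₁ⱼ − x*₀ⱼ|`) and `0 < δ < η/(2(M+3))`, `|k_j| > M`. -/
theorem sepSite_coord_large {x : Fin 2 → EuclideanSpace ℝ (Fin 3)} {j : Fin 3} (hj : (x 0) j ≠ (x 1) j)
    {M : ℝ} (hM : 0 ≤ M) {δ : ℝ} (hδ : 0 < δ) (hδM : δ < |(x 1) j - (x 0) j| / (2 * (M + 3)))
    {y : Fin 2 → EuclideanSpace ℝ (Fin 3)} (hy : dist y x < |(x 1) j - (x 0) j| / 4) :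
    M < |(sepSite δ y j : ℝ)| := by
  set η : ℝ := |(x 1) j - (x 0) j| with hη
  have hηpos : 0 < η := abs_pos.2 (sub_ne_zero.2 (Ne.symm hj))
  -- coordinates of y are close to those of x
  have hc : ∀ i : Fin 2, |(y i) j - (x i) j| < η / 4 := by
    intro i
    have h1 : dist (y i) (x i) < η / 4 := lt_of_le_of_lt (dist_le_pi_dist y x i) hy
    rw [dist_eq_norm] at h1
    have h2 := PiLp.norm_apply_le (y i - x i) j
    rw [Real.norm_eq_abs] at h2
    have h3 : (y i - x i) j = (y i) j - (x i) j := rfl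
    rw [h3] at h2
    linarith
  have hsep : η / 2 < |(y 1) j - (y 0) j| := by
    have h0 := hc 0
    have h1 := hc 1
    rw [abs_lt] at h0 h1
    rw [hη] at *
    rcases le_or_gt 0 ((x 1) j - (x 0) j) with hpos | hneg
    · rw [abs_of_nonneg hpos] at *
      rw [lt_abs]; left; linarith
    · rw [abs_of_neg hneg] at *
      rw [lt_abs]; right; linarith
  have hround := abs_mesh_mul_sepSite_sub_lt hδ y j
  -- δ |k_j| > η/2 - δ ≥ δ (M + 2) > δ M
  have h1 : η / 2 - δ < δ * |(sepSite δ y j : ℝ)| := by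
    have t1 := abs_sub_abs_le_abs_sub ((y 1) j - (y 0) j) (δ * (sepSite δ y j : ℝ))
    rw [abs_sub_comm ((y 1) j - (y 0) j) (δ * (sepSite δ y j : ℝ)), abs_mul, abs_of_pos hδ] at t1
    linarith
  have h2 : δ * (M + 3) < η / 2 := by
    have := (lt_div_iff₀ (by positivity : (0 : ℝ) < 2 * (M + 3))).1 hδM
    linarith
  by_contra hle
  push Not at hle
  have h3 : δ * |(sepSite δ y j : ℝ)| ≤ δ * M := mul_le_mul_of_nonneg_left hle hδ.le
  have h4 : 0 < δ * 3 := by positivity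
  linarith

/-- **The amplitude tends to `1` locally uniformly off the diagonal** (two-point law along the escaping
lattice separation). -/
theorem tendstoLocallyUniformlyOn_ampl {Δ c : ℝ} (hc : 0 < c)
    (hP : Tendsto (fun x : Site 3 =>
      criticalTwoPoint 3 x * Real.sqrt (∑ i, ((x i : ℝ)) ^ 2) ^ (2 * Δ)) cofinite (nhds c)) :
    TendstoLocallyUniformlyOn (ampl Δ c) (fun _ => 1) (𝓝[>] (0 : ℝ)) (NonCoincident 3 2) := by
  rw [Metric.tendstoLocallyUniformlyOn_iff]
  intro ε hε x hx
  -- a separating coordinate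
  have hne : x 0 ≠ x 1 := (injective_fin_two_iff x).1 ((mem_nonCoincident x).1 hx)
  obtain ⟨j, hj⟩ : ∃ j, (x 0) j ≠ (x 1) j := by
    by_contra h
    push Not at h
    exact hne (PiLp.ext h)
  set η : ℝ := |(x 1) j - (x 0) j| with hη
  have hηpos : 0 < η := abs_pos.2 (sub_ne_zero.2 (Ne.symm hj))
  -- the finite exceptional set of the two-point law, and a bound on its `j`-th coordinates
  have hev := Metric.tendsto_nhds.1 hP (ε * c) (by positivity)
  rw [Filter.eventually_cofinite] at hev
  obtain ⟨M₀, hM₀⟩ := (hev.image fun k : Site 3 => |(k j : ℝ)|).bddAbove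
  set M : ℝ := max M₀ 0 with hMdef
  have hM : 0 ≤ M := le_max_right _ _
  have hgood : ∀ k : Site 3, M < |(k j : ℝ)| →
      dist (criticalTwoPoint 3 k * Real.sqrt (∑ i, ((k i : ℝ)) ^ 2) ^ (2 * Δ)) c < ε * c := by
    intro k hk
    by_contra hbad
    have : |(k j : ℝ)| ≤ M₀ := hM₀ ⟨k, hbad, rfl⟩
    linarith [le_max_left M₀ 0]
  refine ⟨NonCoincident 3 2 ∩ Metric.ball x (η / 4),
    inter_mem self_mem_nhdsWithin (mem_nhdsWithin_of_mem_nhds (Metric.ball_mem_nhds x (by positivity))), ?_⟩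
  have hm : (0 : ℝ) < η / (2 * (M + 3)) := by positivity
  filter_upwards [Ioo_mem_nhdsGT hm] with δ hδ y hy
  obtain ⟨hδ0, hδM⟩ := hδ
  have hyball : dist y x < η / 4 := hy.2
  have hlarge : M < |(sepSite δ y j : ℝ)| := sepSite_coord_large hj hM hδ0 hδM hyball
  have hd := hgood (sepSite δ y) hlarge
  rw [Real.dist_eq] at hd ⊢
  rw [ampl]
  have e : 1 - criticalTwoPoint 3 (sepSite δ y) * Real.sqrt (∑ i, ((sepSite δ y i : ℝ)) ^ 2) ^ (2 * Δ) / c =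
      -((criticalTwoPoint 3 (sepSite δ y) * Real.sqrt (∑ i, ((sepSite δ y i : ℝ)) ^ 2) ^ (2 * Δ) - c) / c) := by
    field_simp
    ring
  rw [e, abs_neg, abs_div, abs_of_pos hc, div_lt_iff₀ hc]
  exact hd

/-- **Arity `2` is settled by the two-point law.** Under `P` with witness `(Δ, c)`, the canonically
renormalised pair correlator converges locally uniformly off the diagonal to `c‖x₀ − x₁‖^{-2Δ}`. -/
theorem tendstoLocallyUniformlyOn_arity_two_of_twoPointLaw {Δ c : ℝ} (hc : 0 < c)
    (hP : Tendsto (fun x : Site 3 =>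
      criticalTwoPoint 3 x * Real.sqrt (∑ i, ((x i : ℝ)) ^ 2) ^ (2 * Δ)) cofinite (nhds c)) :
    TendstoLocallyUniformlyOn (rescaledCorrelator (criticalCorr 3) (fun δ => δ ^ (-Δ)) 2)
      (fun x => c * twoPt Δ (x 0) (x 1)) (𝓝[>] (0 : ℝ)) (NonCoincident 3 2) := by
  -- the target is continuous off the diagonal
  have hf : ContinuousOn (fun x : Fin 2 → EuclideanSpace ℝ (Fin 3) => c * twoPt Δ (x 0) (x 1))
      (NonCoincident 3 2) := by
    refine (continuousOn_const.mul (continuousOn_twoPt Δ (0 : Fin 2) 1)).mono fun x hx => ?_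
    exact (injective_fin_two_iff x).1 ((mem_nonCoincident x).1 hx)
  -- B: the target at the rounded configuration converges locally uniformly (rounding moves by ≤ 3δ)
  have hB : TendstoLocallyUniformlyOn (fun δ x => c * twoPt Δ (roundCfg δ x 0) (roundCfg δ x 1))
      (fun x => c * twoPt Δ (x 0) (x 1)) (𝓝[>] (0 : ℝ)) (NonCoincident 3 2) :=
    tendstoLocallyUniformlyOn_comp_approx (isOpen_nonCoincident 3 2) hf (fun δ x => roundCfg δ x) 3
      (fun δ hδ x => dist_round_le hδ x)
  -- A · B → 1 · target
  have hAB := (tendstoLocallyUniformlyOn_ampl hc hP).mul₀ hB continuousOn_const hf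
  have hAB' : TendstoLocallyUniformlyOn
      (fun δ x => ampl Δ c δ x * (c * twoPt Δ (roundCfg δ x 0) (roundCfg δ x 1)))
      (fun x => c * twoPt Δ (x 0) (x 1)) (𝓝[>] (0 : ℝ)) (NonCoincident 3 2) := by
    refine (hAB.congr_right fun x _ => ?_)
    simp
  -- and A · B IS the rescaled correlator, locally eventually
  refine tendstoLocallyUniformlyOn_congr_local hAB' fun x hx => ?_
  have hne : x 0 ≠ x 1 := (injective_fin_two_iff x).1 ((mem_nonCoincident x).1 hx)
  obtain ⟨j, hj⟩ : ∃ j, (x 0) j ≠ (x 1) j := by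
    by_contra h
    push Not at h
    exact hne (PiLp.ext h)
  set η : ℝ := |(x 1) j - (x 0) j| with hη
  have hηpos : 0 < η := abs_pos.2 (sub_ne_zero.2 (Ne.symm hj))
  refine ⟨NonCoincident 3 2 ∩ Metric.ball x (η / 4),
    inter_mem self_mem_nhdsWithin (mem_nhdsWithin_of_mem_nhds (Metric.ball_mem_nhds x (by positivity))), ?_⟩
  have hm : (0 : ℝ) < η / (2 * (0 + 3)) := by positivity
  filter_upwards [Ioo_mem_nhdsGT hm] with δ hδ y hy
  obtain ⟨hδ0, hδM⟩ := hδ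
  have hlarge : (0 : ℝ) < |(sepSite δ y j : ℝ)| := sepSite_coord_large hj le_rfl hδ0 hδM hy.2
  have hk : sepSite δ y ≠ 0 := by
    intro h0
    rw [h0] at hlarge
    simp at hlarge
  exact (rescaledCorrelator_arity_two_eq_mul hc.ne' hδ0 y hk).symm

end Summit.CriticalPhenomena.Ising3DConformalLimit.Theorems.MoebiusLimitOfTwoPointLaw.Negative

end
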